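/-
Copyright (c) 2026 the pub-hodgecm-mathlib formalisation cell (harness21).  Prover seat hodgecm-mathlib-K2E3-p27 (g4), Track B «K2-LIT», h413 = `stmt-HodgeConjecture-24833`,
route `HCCMUnconditional`, R90-TF S8; deal S8-R261 (2) (S8 dealer R90-CS-plan (g4)), brick UB-OD-1 of the joint census `R90/S8/CENSUS-UBody-bricks.K2E3-p27-K2E4-p14.md` f4792640bfd68b67:
the OFF-DUAL per-block letter of ★ p865199's row packaging AT EVERY LEVEL OF RECORD `(Kad K′_f, 1)`, letter-light — ★ p863116 §3 with `U₀` (★ p865245 UB-OD-3) and the level idempotent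
`e` (★ `R90.S8.exists_levelIdempotent`) DISCHARGED; visible: the structural measures (UB-SD-3) and the continuity of sections `hVc` (UB-OD-2).
-/
import Summits.HodgeConjecture.HodgeConjecture.Theorems.R90S8ResHRowPackageOfBlockLettersU2      -- ★ p865199 (this seat) UB-PK-1: the per-block letter shapes; H7's carriers
import Summits.HodgeConjecture.HodgeConjecture.Theorems.R90S8ResHOffDualNoLineMassU2            -- ★ p863116 (K2E1-p12) §3: `subrep_le_orthogonal_resHBlock_offDual_kad` ((N_blk)-OD at `Kad K′_f`)
import Summits.HodgeConjecture.HodgeConjecture.Theorems.R90S8FinLevelOpenCompactCutU              -- ★ p865245 (K2E5-p17) UB-OD-3: `exists_openCompact_cut_cm_two`, `coe_mem_glFiniteIntegralLevel_of_mem_of_le_maximalLevelFin`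
import Summits.HodgeConjecture.HodgeConjecture.Theorems.R90S8LevelIdempotentOfCompactOpenU       -- ★ (K2E1-p14 (g4)): `R90.S8.exists_levelIdempotent` (`e he0 he1 heK hestar`), `isCompact_of_isOpen_of_le_maximalLevelFin`
import Literature.NumberTheory.Automorphic.UnitaryGroupIwasawaIntegration                        -- ★ `isCompact_comap_adelicVal_standardMaximalCompactGL` (`K_max` compact ⇒ its Haar measure)
import HarnessLib

/-!
# S8 #4′ road — `R90S8ResHRowOffDualLetterKadU2` (UB-OD-1): THE OFF-DUAL PER-BLOCK LETTER AT EVERY LEVEL OF RECORD `(Kad K′_f, 1)`, LETTER-LIGHT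

Track B ∕ K2-LIT, crux h413 = `stmt-HodgeConjecture-24833`, route of record `HCCMUnconditional`; cell `hodgecm-mathlib`, R90-TF S8 «ContSpec-n½», socket #4′
`sock_S8_resH_spannedByCharLines` (`Lines/R90_S8_ResidualSpectrumU3B.lean` ED. 7 :494–:503) = ★ p865023 `resH_spannedByCharLines_cm_of_rows ‹hrows›`, a row = ★ p865199
`rowBody_of_blockLetters (hSD) (hNOD)`.  THEOREMS ONLY (no `def`, no `instance`, no `notation`, no named-fact hypothesis, no `sorry`; default heartbeats); lane
`--supports stmt-HodgeConjecture-24833 --as helper` (count-neutral).  CLOSES NO SOCKET.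

WHY ([MoeglinWaldspurger1995, IV.1.10, IV.3.12, VI.2]; [BorelJacquet1979, §4.1]).  The `hNOD` input of ★ p865199 at a row `(Kf, 1)` is «for every OFF-DUAL block `b` of `S_1(Kad Kf)` and EVERY
model `U′`, `W′ ⊓ Iso(Kad Kf, 1) ≤ (resHLine U′)ᗮ` for all irreducible closed `W′`».  ★ p863116 §3 `subrep_le_orthogonal_resHBlock_offDual_kad` proves the stronger `W′ ⟂ resHBlock` at
`(Kad K′_f, 1)` for every `K′_f ⊆ GL₂(𝒪̂_L)` open, modulo: the structural measures `νinf νf μK χ₁` (trivial `K_∞`-type), the LEVEL IDEMPOTENT `e` of `K′_f` (`he0 he1 heK hestar`), an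
open compact `U₀ ≤ GL₂(𝔸_{L,f})` cutting out `K′_f`, a Haar measure on `K_max`, and the continuity of the sections of `V(χ, Kad K′_f, 1)`.  Three of these are now ★ for EVERY level
of record `K′_f ≤ K₀` open: `U₀` = ★ p865245 `exists_openCompact_cut_cm_two` (K2E5-p17, UB-OD-3), `e` = ★ `R90.S8.exists_levelIdempotent νf` at the compact-open `K′_f` (★
`isCompact_of_isOpen_of_le_maximalLevelFin`), `μKU := haar` on the compact `K_max`; the integrality of `K′_f`'s members is ★ `coe_mem_glFiniteIntegralLevel_of_mem_of_le_maximalLevelFin`.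
So the off-dual letter at `(Kad K′_f, 1)` is **`hNOD_kad_of_structural (νinf νf μK χ₁) (hχ1) (K′_f) (hK′o) (hle) (hVc)`** — visible ONLY the four structural data (UB-SD-3's ∃-package,
K2E4-p14) and UB-OD-2 `hVc` «sections of `V(χ, Kad K′_f, 1)` are continuous» (★ at `K_max`: `hVc_maximalLevel_one`; below: unowned).
* §1 **`hNOD_kad_of_structural`** — THE OFF-DUAL LETTER of ★ p865199 at `(Kad K′_f, (1 : ↥(Kad K′_f) →* ℂ))`, every `K′_f ≤ K₀` open.
HONEST LABEL: HC_CM is proved only modulo the 7 printed citations (2 remaining named inputs: hLiu418 = `stmt-HodgeConjecture-24832`, h413 = `stmt-HodgeConjecture-24833`) until rung 0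
closes; REL ≠ ★ ≠ BUILT; this file asserts no named fact, is conditional on the structural measures and `hVc`, and closes no socket (#4′ OPEN: the self-dual letter below `K_max` is the
G9 rank-n package, `ω ≠ 1` rows have no kit); count-neutral.

## References
* [MoeglinWaldspurger1995] C. Mœglin, J.-L. Waldspurger, *Spectral Decomposition and Eisenstein Series* (1995), IV.1.10, IV.3.12, V.3.13, VI.2.
* [BorelJacquet1979] A. Borel, H. Jacquet, *Automorphic forms and automorphic representations*, PSPM 33.1 (1979), §4.1.
-/

set_option autoImplicit false
set_option linter.dupNamespace false  -- the mandated namespace `…HodgeConjecture.HodgeConjecture.R90.S8` (LEAD #1 L1) repeats the summit's segment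

noncomputable section

open MeasureTheory Measure Set Filter Topology NumberField NumberField.mixedEmbedding IsDedekindDomain
open Literature.MeasureTheory.Group Literature.NumberTheory.Automorphic Literature.NumberTheory.Automorphic.UnitaryGroup Literature.NumberTheory.GaloisRepresentations AdelicGroupData ContRepresentation
open Literature.NumberTheory.Automorphic.Arthur2013.Leaves.TECR
open Summit.HodgeConjecture.HodgeConjecture.Cruxes.H413.K2E1BorelEisensteinU
open Summit.HodgeConjecture.HodgeConjecture.Cruxes.H413.K2E1CharacterEisensteinU2Defs
open Summit.HodgeConjecture.HodgeConjecture.Cruxes.H413.K2E1ChiSectionSpaceU2Defs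
open Summit.HodgeConjecture.HodgeConjecture.Cruxes.H413.K2E1FamilyIndexSplitSelfDualU2 (not_isNormTwist_mul_inv_reflectChar_of_rayTrivial_of_ne)
open scoped ENNReal NNReal Pointwise
open CompactlySupported

namespace Summit.HodgeConjecture.HodgeConjecture.R90.S8

variable (L : Type) [Field L] [NumberField L] [IsCMField L]
  (μ : Measure (quasiSplit (↥(maximalRealSubfield L)) L (IsCMField.complexConj L) 2).automorphicQuotient) [(quasiSplit (↥(maximalRealSubfield L)) L (IsCMField.complexConj L) 2).IsAutomorphicMeasure μ]

/-! ## §1 The off-dual letter at `(Kad K′_f, 1)`, letter-light -/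

/-- **THE OFF-DUAL PER-BLOCK LETTER AT A LEVEL OF RECORD (UB-OD-1).**  For every open finite level `K′_f ≤ K₀ = ι_f⁻¹(val⁻¹(K_∞·GL₂(𝒪̂_L)))`: IF the sections of `V(χ, Kad K′_f, 1)` are
continuous for every `χ` (`hVc`, UB-OD-2) and the structural measures of ★ p863116 are given (`νinf νf μK χ₁`, trivial `K_∞`-type `χ₁ ≡ 1` — UB-SD-3), THEN for every OFF-DUAL block `b` of
`S_1(Kad K′_f)` (`χ_b` ray-trivial ⇒ unitary ★ `isUnitary_coe_index`; `χ_bʷ ≠ χ_b` ⇒ off-dual ★ `not_isNormTwist_mul_inv_reflectChar_of_rayTrivial_of_ne`), every model `U′` and every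
irreducible closed `W′`: `W′ ⊓ Iso(Kad K′_f, 1) ≤ (resHLine L μ U′ (Kad K′_f) 1 χ_b)ᗮ` — ★ `subrep_le_orthogonal_resHBlock_offDual_kad` with `U₀` ★ p865245, `e` ★ `exists_levelIdempotent`,
`μKU := haar` on the compact `K_max`, weakened along `resHLine ≤ resHBlock`. [cite: MoeglinWaldspurger1995, IV.1.10, IV.3.12, VI.2] [cite: BorelJacquet1979, §4.1] -/
theorem hNOD_kad_of_structural
    [MeasurableSpace (quasiSplit (↥(maximalRealSubfield L)) L (IsCMField.complexConj L) 2).Adelic] [BorelSpace (quasiSplit (↥(maximalRealSubfield L)) L (IsCMField.complexConj L) 2).Adelic]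
    [MeasurableSpace (UnitaryGroup.arch (↥(maximalRealSubfield L)) L (IsCMField.complexConj L) 2 ((StdForm.antidiagonal 2).over L))] [BorelSpace (UnitaryGroup.arch (↥(maximalRealSubfield L)) L (IsCMField.complexConj L) 2 ((StdForm.antidiagonal 2).over L))]
    [MeasurableSpace (finAdelic (↥(maximalRealSubfield L)) L (IsCMField.complexConj L) 2 ((StdForm.antidiagonal 2).over L))] [BorelSpace (finAdelic (↥(maximalRealSubfield L)) L (IsCMField.complexConj L) 2 ((StdForm.antidiagonal 2).over L))]
    (νinf : Measure (UnitaryGroup.arch (↥(maximalRealSubfield L)) L (IsCMField.complexConj L) 2 ((StdForm.antidiagonal 2).over L))) [IsHaarMeasure νinf] [νinf.IsInvInvariant] [SFinite νinf]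
    (νf : Measure (finAdelic (↥(maximalRealSubfield L)) L (IsCMField.complexConj L) 2 ((StdForm.antidiagonal 2).over L))) [IsFiniteMeasureOnCompacts νf] [νf.IsMulLeftInvariant] [νf.IsInvInvariant] [νf.IsOpenPosMeasure]
    [MeasurableSpace ↥(UnitaryGroup.arch (↥(maximalRealSubfield L)) L (IsCMField.complexConj L) 2 ((StdForm.antidiagonal 2).over L) ⊓ unitaryGroupOfForm (conjMixed (↥(maximalRealSubfield L)) L (IsCMField.complexConj L)) 1)] [BorelSpace ↥(UnitaryGroup.arch (↥(maximalRealSubfield L)) L (IsCMField.complexConj L) 2 ((StdForm.antidiagonal 2).over L) ⊓ unitaryGroupOfForm (conjMixed (↥(maximalRealSubfield L)) L (IsCMField.complexConj L)) 1)]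
    (μK : Measure ↥(UnitaryGroup.arch (↥(maximalRealSubfield L)) L (IsCMField.complexConj L) 2 ((StdForm.antidiagonal 2).over L) ⊓ unitaryGroupOfForm (conjMixed (↥(maximalRealSubfield L)) L (IsCMField.complexConj L)) 1)) [IsProbabilityMeasure μK] [μK.IsMulLeftInvariant] [μK.IsMulRightInvariant] [μK.IsInvInvariant]
    (χ₁ : C_c(↥(UnitaryGroup.arch (↥(maximalRealSubfield L)) L (IsCMField.complexConj L) 2 ((StdForm.antidiagonal 2).over L) ⊓ unitaryGroupOfForm (conjMixed (↥(maximalRealSubfield L)) L (IsCMField.complexConj L)) 1), ℂ)) [MeasurableMul (finAdelic (↥(maximalRealSubfield L)) L (IsCMField.complexConj L) 2 ((StdForm.antidiagonal 2).over L))] [ENNReal.HolderTriple ∞ 2 2] (hχ1 : ∀ k, χ₁ k = 1)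
    (K'f : Subgroup ↥(finAdelic (↥(maximalRealSubfield L)) L (IsCMField.complexConj L) 2 ((StdForm.antidiagonal 2).over L))) (hK'o : IsOpen ((K'f : Subgroup ↥(finAdelic (↥(maximalRealSubfield L)) L (IsCMField.complexConj L) 2 ((StdForm.antidiagonal 2).over L))) : Set ↥(finAdelic (↥(maximalRealSubfield L)) L (IsCMField.complexConj L) 2 ((StdForm.antidiagonal 2).over L)))) (hle : K'f ≤ ((((standardMaximalCompactGL 2 L).comap (adelicVal (↥(maximalRealSubfield L)) L (IsCMField.complexConj L) 2 ((StdForm.antidiagonal 2).over L)) : Subgroup (quasiSplit (↥(maximalRealSubfield L)) L (IsCMField.complexConj L) 2).Adelic)).comap (finAdelicToAdelic (↥(maximalRealSubfield L)) L (IsCMField.complexConj L) 2 ((StdForm.antidiagonal 2).over L)) : Subgroup ↥(finAdelic (↥(maximalRealSubfield L)) L (IsCMField.complexConj L) 2 ((StdForm.antidiagonal 2).over L))))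
    (hVc : ∀ (χ : HeckeCharacter L), ∀ φ ∈ chiSectionSpace χ (Subgroup.closure ((Set.range (fun k : ↥(UnitaryGroup.arch (↥(maximalRealSubfield L)) L (IsCMField.complexConj L) 2 ((StdForm.antidiagonal 2).over L) ⊓ unitaryGroupOfForm (conjMixed (↥(maximalRealSubfield L)) L (IsCMField.complexConj L)) 1) => (archToAdelic (↥(maximalRealSubfield L)) L (IsCMField.complexConj L) 2 ((StdForm.antidiagonal 2).over L)) (Subgroup.inclusion inf_le_left k)) ∪
            (finAdelicToAdelic (↥(maximalRealSubfield L)) L (IsCMField.complexConj L) 2 ((StdForm.antidiagonal 2).over L)) '' ((K'f : Subgroup ↥(finAdelic (↥(maximalRealSubfield L)) L (IsCMField.complexConj L) 2 ((StdForm.antidiagonal 2).over L))) : Set ↥(finAdelic (↥(maximalRealSubfield L)) L (IsCMField.complexConj L) 2 ((StdForm.antidiagonal 2).over L)))) : Set (quasiSplit (↥(maximalRealSubfield L)) L (IsCMField.complexConj L) 2).Adelic)) 1, Continuous φ) :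
    ∀ b : ↥{χ : HeckeCharacter L | (∀ r : ℝ≥0ˣ, χ (posRealIdele L r) = 1) ∧ chiSectionSpace χ (Subgroup.closure ((Set.range (fun k : ↥(UnitaryGroup.arch (↥(maximalRealSubfield L)) L (IsCMField.complexConj L) 2 ((StdForm.antidiagonal 2).over L) ⊓ unitaryGroupOfForm (conjMixed (↥(maximalRealSubfield L)) L (IsCMField.complexConj L)) 1) => (archToAdelic (↥(maximalRealSubfield L)) L (IsCMField.complexConj L) 2 ((StdForm.antidiagonal 2).over L)) (Subgroup.inclusion inf_le_left k)) ∪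
            (finAdelicToAdelic (↥(maximalRealSubfield L)) L (IsCMField.complexConj L) 2 ((StdForm.antidiagonal 2).over L)) '' ((K'f : Subgroup ↥(finAdelic (↥(maximalRealSubfield L)) L (IsCMField.complexConj L) 2 ((StdForm.antidiagonal 2).over L))) : Set ↥(finAdelic (↥(maximalRealSubfield L)) L (IsCMField.complexConj L) 2 ((StdForm.antidiagonal 2).over L)))) : Set (quasiSplit (↥(maximalRealSubfield L)) L (IsCMField.complexConj L) 2).Adelic)) (((1 : ↥(Subgroup.closure ((Set.range (fun k : ↥(UnitaryGroup.arch (↥(maximalRealSubfield L)) L (IsCMField.complexConj L) 2 ((StdForm.antidiagonal 2).over L) ⊓ unitaryGroupOfForm (conjMixed (↥(maximalRealSubfield L)) L (IsCMField.complexConj L)) 1) => (archToAdelic (↥(maximalRealSubfield L)) L (IsCMField.complexConj L) 2 ((StdForm.antidiagonal 2).over L)) (Subgroup.inclusion inf_le_left k)) ∪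
            (finAdelicToAdelic (↥(maximalRealSubfield L)) L (IsCMField.complexConj L) 2 ((StdForm.antidiagonal 2).over L)) '' ((K'f : Subgroup ↥(finAdelic (↥(maximalRealSubfield L)) L (IsCMField.complexConj L) 2 ((StdForm.antidiagonal 2).over L))) : Set ↥(finAdelic (↥(maximalRealSubfield L)) L (IsCMField.complexConj L) 2 ((StdForm.antidiagonal 2).over L)))) : Set (quasiSplit (↥(maximalRealSubfield L)) L (IsCMField.complexConj L) 2).Adelic)) →* ℂ)) : ↥(Subgroup.closure ((Set.range (fun k : ↥(UnitaryGroup.arch (↥(maximalRealSubfield L)) L (IsCMField.complexConj L) 2 ((StdForm.antidiagonal 2).over L) ⊓ unitaryGroupOfForm (conjMixed (↥(maximalRealSubfield L)) L (IsCMField.complexConj L)) 1) => (archToAdelic (↥(maximalRealSubfield L)) L (IsCMField.complexConj L) 2 ((StdForm.antidiagonal 2).over L)) (Subgroup.inclusion inf_le_left k)) ∪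
            (finAdelicToAdelic (↥(maximalRealSubfield L)) L (IsCMField.complexConj L) 2 ((StdForm.antidiagonal 2).over L)) '' ((K'f : Subgroup ↥(finAdelic (↥(maximalRealSubfield L)) L (IsCMField.complexConj L) 2 ((StdForm.antidiagonal 2).over L))) : Set ↥(finAdelic (↥(maximalRealSubfield L)) L (IsCMField.complexConj L) 2 ((StdForm.antidiagonal 2).over L)))) : Set (quasiSplit (↥(maximalRealSubfield L)) L (IsCMField.complexConj L) 2).Adelic)) → ℂ) ≠ ⊥}, reflectChar (IsCMField.complexConj L) (b : HeckeCharacter L) ≠ (b : HeckeCharacter L) →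
    ∀ (A Λ : Type) [AddCommGroup A] [Module ℂ A] [AddCommGroup Λ] [Module ℂ Λ] (U' : (quasiSplit (↥(maximalRealSubfield L)) L (IsCMField.complexConj L) 2).L2 μ →ₗ[ℂ] A × Λ),
      ∀ (W' : ClosedSubrep ((quasiSplit (↥(maximalRealSubfield L)) L (IsCMField.complexConj L) 2).rightRegular μ)), W'.toContRep.IsTopIrreducible →
          W'.toSubmodule ⊓ (⨅ k : ↥(Subgroup.closure ((Set.range (fun k : ↥(UnitaryGroup.arch (↥(maximalRealSubfield L)) L (IsCMField.complexConj L) 2 ((StdForm.antidiagonal 2).over L) ⊓ unitaryGroupOfForm (conjMixed (↥(maximalRealSubfield L)) L (IsCMField.complexConj L)) 1) => (archToAdelic (↥(maximalRealSubfield L)) L (IsCMField.complexConj L) 2 ((StdForm.antidiagonal 2).over L)) (Subgroup.inclusion inf_le_left k)) ∪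
            (finAdelicToAdelic (↥(maximalRealSubfield L)) L (IsCMField.complexConj L) 2 ((StdForm.antidiagonal 2).over L)) '' ((K'f : Subgroup ↥(finAdelic (↥(maximalRealSubfield L)) L (IsCMField.complexConj L) 2 ((StdForm.antidiagonal 2).over L))) : Set ↥(finAdelic (↥(maximalRealSubfield L)) L (IsCMField.complexConj L) 2 ((StdForm.antidiagonal 2).over L)))) : Set (quasiSplit (↥(maximalRealSubfield L)) L (IsCMField.complexConj L) 2).Adelic)), Module.End.eigenspace ((((quasiSplit (↥(maximalRealSubfield L)) L (IsCMField.complexConj L) 2).rightRegular μ) ((Subgroup.closure ((Set.range (fun k : ↥(UnitaryGroup.arch (↥(maximalRealSubfield L)) L (IsCMField.complexConj L) 2 ((StdForm.antidiagonal 2).over L) ⊓ unitaryGroupOfForm (conjMixed (↥(maximalRealSubfield L)) L (IsCMField.complexConj L)) 1) => (archToAdelic (↥(maximalRealSubfield L)) L (IsCMField.complexConj L) 2 ((StdForm.antidiagonal 2).over L)) (Subgroup.inclusion inf_le_left k)) ∪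
            (finAdelicToAdelic (↥(maximalRealSubfield L)) L (IsCMField.complexConj L) 2 ((StdForm.antidiagonal 2).over L)) '' ((K'f : Subgroup ↥(finAdelic (↥(maximalRealSubfield L)) L (IsCMField.complexConj L) 2 ((StdForm.antidiagonal 2).over L))) : Set ↥(finAdelic (↥(maximalRealSubfield L)) L (IsCMField.complexConj L) 2 ((StdForm.antidiagonal 2).over L)))) : Set (quasiSplit (↥(maximalRealSubfield L)) L (IsCMField.complexConj L) 2).Adelic)).subtype k) : (quasiSplit (↥(maximalRealSubfield L)) L (IsCMField.complexConj L) 2).L2 μ →L[ℂ] (quasiSplit (↥(maximalRealSubfield L)) L (IsCMField.complexConj L) 2).L2 μ) :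
          (quasiSplit (↥(maximalRealSubfield L)) L (IsCMField.complexConj L) 2).L2 μ →ₗ[ℂ] (quasiSplit (↥(maximalRealSubfield L)) L (IsCMField.complexConj L) 2).L2 μ) (((1 : ↥(Subgroup.closure ((Set.range (fun k : ↥(UnitaryGroup.arch (↥(maximalRealSubfield L)) L (IsCMField.complexConj L) 2 ((StdForm.antidiagonal 2).over L) ⊓ unitaryGroupOfForm (conjMixed (↥(maximalRealSubfield L)) L (IsCMField.complexConj L)) 1) => (archToAdelic (↥(maximalRealSubfield L)) L (IsCMField.complexConj L) 2 ((StdForm.antidiagonal 2).over L)) (Subgroup.inclusion inf_le_left k)) ∪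
            (finAdelicToAdelic (↥(maximalRealSubfield L)) L (IsCMField.complexConj L) 2 ((StdForm.antidiagonal 2).over L)) '' ((K'f : Subgroup ↥(finAdelic (↥(maximalRealSubfield L)) L (IsCMField.complexConj L) 2 ((StdForm.antidiagonal 2).over L))) : Set ↥(finAdelic (↥(maximalRealSubfield L)) L (IsCMField.complexConj L) 2 ((StdForm.antidiagonal 2).over L)))) : Set (quasiSplit (↥(maximalRealSubfield L)) L (IsCMField.complexConj L) 2).Adelic)) →* ℂ)) k)) ≤ (resHLine L μ (U') (Subgroup.closure ((Set.range (fun k : ↥(UnitaryGroup.arch (↥(maximalRealSubfield L)) L (IsCMField.complexConj L) 2 ((StdForm.antidiagonal 2).over L) ⊓ unitaryGroupOfForm (conjMixed (↥(maximalRealSubfield L)) L (IsCMField.complexConj L)) 1) => (archToAdelic (↥(maximalRealSubfield L)) L (IsCMField.complexConj L) 2 ((StdForm.antidiagonal 2).over L)) (Subgroup.inclusion inf_le_left k)) ∪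
            (finAdelicToAdelic (↥(maximalRealSubfield L)) L (IsCMField.complexConj L) 2 ((StdForm.antidiagonal 2).over L)) '' ((K'f : Subgroup ↥(finAdelic (↥(maximalRealSubfield L)) L (IsCMField.complexConj L) 2 ((StdForm.antidiagonal 2).over L))) : Set ↥(finAdelic (↥(maximalRealSubfield L)) L (IsCMField.complexConj L) 2 ((StdForm.antidiagonal 2).over L)))) : Set (quasiSplit (↥(maximalRealSubfield L)) L (IsCMField.complexConj L) 2).Adelic)) (1 : ↥(Subgroup.closure ((Set.range (fun k : ↥(UnitaryGroup.arch (↥(maximalRealSubfield L)) L (IsCMField.complexConj L) 2 ((StdForm.antidiagonal 2).over L) ⊓ unitaryGroupOfForm (conjMixed (↥(maximalRealSubfield L)) L (IsCMField.complexConj L)) 1) => (archToAdelic (↥(maximalRealSubfield L)) L (IsCMField.complexConj L) 2 ((StdForm.antidiagonal 2).over L)) (Subgroup.inclusion inf_le_left k)) ∪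
            (finAdelicToAdelic (↥(maximalRealSubfield L)) L (IsCMField.complexConj L) 2 ((StdForm.antidiagonal 2).over L)) '' ((K'f : Subgroup ↥(finAdelic (↥(maximalRealSubfield L)) L (IsCMField.complexConj L) 2 ((StdForm.antidiagonal 2).over L))) : Set ↥(finAdelic (↥(maximalRealSubfield L)) L (IsCMField.complexConj L) 2 ((StdForm.antidiagonal 2).over L)))) : Set (quasiSplit (↥(maximalRealSubfield L)) L (IsCMField.complexConj L) 2).Adelic)) →* ℂ) (b : HeckeCharacter L))ᗮ := by
  intro b hb A Λ _ _ _ _ U' W' hW'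
  -- UB-OD-3 ★ p865245: the open compact `U₀ ≤ GL₂(𝒪̂_L)` cutting out `K′_f`
  have HU := exists_openCompact_cut_cm_two L hK'o hle
  obtain ⟨U₀, hU₀o, hU₀c, -, hK'U₀⟩ := HU
  -- the level idempotent of the compact-open `K′_f` ★
  have He := exists_levelIdempotent νf hK'o (isCompact_of_isOpen_of_le_maximalLevelFin (↥(maximalRealSubfield L)) L (IsCMField.complexConj L) 2 hK'o hle)
  obtain ⟨e, he0, he1, heK, hestar⟩ := He
  -- a Haar measure on the compact `K_max`
  haveI : CompactSpace ↥(((standardMaximalCompactGL 2 L).comap (adelicVal (↥(maximalRealSubfield L)) L (IsCMField.complexConj L) 2 ((StdForm.antidiagonal 2).over L)) : Subgroup (quasiSplit (↥(maximalRealSubfield L)) L (IsCMField.complexConj L) 2).Adelic)) :=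
    isCompact_iff_compactSpace.1 isCompact_comap_adelicVal_standardMaximalCompactGL
  exact inf_le_left.trans ((subrep_le_orthogonal_resHBlock_offDual_kad L μ νinf νf μK χ₁ e hχ1 K'f hK'o
    (fun u hu => coe_mem_glFiniteIntegralLevel_of_mem_of_le_maximalLevelFin (↥(maximalRealSubfield L)) L (IsCMField.complexConj L) 2 hle hu) he0 he1 heK hestar U₀ hU₀o hU₀c hK'U₀
    (haar : Measure ↥(((standardMaximalCompactGL 2 L).comap (adelicVal (↥(maximalRealSubfield L)) L (IsCMField.complexConj L) 2 ((StdForm.antidiagonal 2).over L)) : Subgroup (quasiSplit (↥(maximalRealSubfield L)) L (IsCMField.complexConj L) 2).Adelic)))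
    (isUnitary_coe_index L (Subgroup.closure ((Set.range (fun k : ↥(UnitaryGroup.arch (↥(maximalRealSubfield L)) L (IsCMField.complexConj L) 2 ((StdForm.antidiagonal 2).over L) ⊓ unitaryGroupOfForm (conjMixed (↥(maximalRealSubfield L)) L (IsCMField.complexConj L)) 1) => (archToAdelic (↥(maximalRealSubfield L)) L (IsCMField.complexConj L) 2 ((StdForm.antidiagonal 2).over L)) (Subgroup.inclusion inf_le_left k)) ∪
            (finAdelicToAdelic (↥(maximalRealSubfield L)) L (IsCMField.complexConj L) 2 ((StdForm.antidiagonal 2).over L)) '' ((K'f : Subgroup ↥(finAdelic (↥(maximalRealSubfield L)) L (IsCMField.complexConj L) 2 ((StdForm.antidiagonal 2).over L))) : Set ↥(finAdelic (↥(maximalRealSubfield L)) L (IsCMField.complexConj L) 2 ((StdForm.antidiagonal 2).over L)))) : Set (quasiSplit (↥(maximalRealSubfield L)) L (IsCMField.complexConj L) 2).Adelic)) (1 : ↥(Subgroup.closure ((Set.range (fun k : ↥(UnitaryGroup.arch (↥(maximalRealSubfield L)) L (IsCMField.complexConj L) 2 ((StdForm.antidiagonal 2).over L) ⊓ unitaryGroupOfForm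 (conjMixed (↥(maximalRealSubfield L)) L (IsCMField.complexConj L)) 1) => (archToAdelic (↥(maximalRealSubfield L)) L (IsCMField.complexConj L) 2 ((StdForm.antidiagonal 2).over L)) (Subgroup.inclusion inf_le_left k)) ∪
            (finAdelicToAdelic (↥(maximalRealSubfield L)) L (IsCMField.complexConj L) 2 ((StdForm.antidiagonal 2).over L)) '' ((K'f : Subgroup ↥(finAdelic (↥(maximalRealSubfield L)) L (IsCMField.complexConj L) 2 ((StdForm.antidiagonal 2).over L))) : Set ↥(finAdelic (↥(maximalRealSubfield L)) L (IsCMField.complexConj L) 2 ((StdForm.antidiagonal 2).over L)))) : Set (quasiSplit (↥(maximalRealSubfield L)) L (IsCMField.complexConj L) 2).Adelic)) →* ℂ) b) (not_isNormTwist_mul_inv_reflectChar_of_rayTrivial_of_ne b.2.1 hb)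
    (hVc (b : HeckeCharacter L)) W' hW').trans
    (Submodule.orthogonal_le (resHLine_le_resHBlock L μ U' _ _ _)))

end Summit.HodgeConjecture.HodgeConjecture.R90.S8

end
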